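import Literature.Computability.AlgebraicComplexity.SparseRowLUCertificate
import HarnessLib

/-!
# Row-sparse LU rank certificates, II: packed-row arithmetic (kernel-checkable at `k ≈ 2000`)

Topic `Literature/Computability/AlgebraicComplexity`; sequel of `SparseRowLUCertificate.lean`
(same certificate data `RowLU.Cert`, same soundness shape), for the `2058 × 2058` minor of the
`q = 5` base block of the cube of `T_{cw,q}` (CGLV 2022, Thm. 1.2 / Thm. 3.4; `CwCubeKoszulCert.lean`).
There the rows of `L · U` of the late pivots combine hundreds of rows of `U`, and merging sorted
lists in the kernel costs milliseconds per entry.  Here a sparse row modulo `pr` is PACKED into one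
natural number, `20` bits per column (`packRow`), so that the row `acc = U_i + ∑ L_{is} U_s` is a
handful of big-number operations (which the kernel delegates to GMP), and the comparison with the
row of `A` is one more: the row of `A` modulo `pr` on the columns of the minor is packed the same
way while visiting the candidate columns (`candFold`, `E`), and `acc ≡ E` column-wise modulo `pr` is
certified by `acc = E + pr · Q` together with `Q &&& himask = 0` (every `20`-bit field of
`Q = (acc - E) / pr` is `< 2¹²`, so that no field of `E + pr · Q` overflows and the identity can be
read field by field).  PROVED here ([folklore] throughout):

* `RowLU.peel`, `RowLU.decodeRow`, `RowLU.Cert.uRowF`, `RowLU.Cert.lRowF` — decoding a row with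
  one shift of the big numerals.
* `RowLU.digitSum`, `digitSum_div_mod`, `digitSum_lt`, `digitSum_add`, `digitSum_injOn` — base-`B`
  digit sums and the uniqueness of digits.
* `RowLU.packRow`, `packRow_eq_digitSum`; `RowLU.accPacked`, `accPacked_eq_digitSum` (its digits are
  the exact natural-number entries `X_{it} = U_{it} + ∑_{(s,v) ∈ L_i} v U_{st}` of `L · U`),
  `RowLU.rowBound` (a checked bound making them honest digits).
* `RowLU.himask`, `digit_lt_of_and_himask_eq_zero` — the field mask and what it certifies.
* `RowLU.candFold`, `candFold_spec` — the packed row `E` of `A` modulo `pr` on the visited columns.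
* `RowLU.rowCheckP`, `RowLU.rowsCheckP`, `rowsCheckP_spec`, and **soundness**
  `RowLU.le_rank_of_checksP` (same hypotheses and conclusion as `le_rank_of_checks`, plus `pr < 2⁸`).
-/

namespace Literature.Computability.AlgebraicComplexity

namespace RowLU

open Matrix Finset

/-! ## Fast decoding of a row -/

/-- Peeling `n` `(key, value)` fields off the low ends of `x` and `y`. [folklore] -/
def peel (wk wv : ℕ) : ℕ → ℕ → ℕ → List (ℕ × ℕ)
  | _, _, 0 => []
  | x, y, n + 1 => (x &&& (2 ^ wk - 1), y &&& (2 ^ wv - 1)) :: peel wk wv (x >>> wk) (y >>> wv) n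

/-- The `n` consecutive `(key, value)` fields from position `a` on (one shift-and-mask of each big
numeral, then peeling of the small remainders). [folklore] -/
def decodeRow (key val wk wv a n : ℕ) : List (ℕ × ℕ) :=
  peel wk wv ((key >>> (wk * a)) &&& (2 ^ (wk * n) - 1)) ((val >>> (wv * a)) &&& (2 ^ (wv * n) - 1)) n

/-- Row `s` of `U`, decoded fast. [folklore] -/
def Cert.uRowF (C : Cert) (s : ℕ) : List (ℕ × ℕ) :=
  decodeRow C.uKey C.uVal C.wk C.wv (getW C.uOff C.wo s) (getW C.uOff C.wo (s + 1) - getW C.uOff C.wo s)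

/-- Row `i` of `L`, decoded fast. [folklore] -/
def Cert.lRowF (C : Cert) (i : ℕ) : List (ℕ × ℕ) :=
  decodeRow C.lKey C.lVal C.wk C.wv (getW C.lOff C.wo i) (getW C.lOff C.wo (i + 1) - getW C.lOff C.wo i)

/-- Every decoded value is `< 2 ^ wv`. [folklore] -/
theorem peel_val_lt (wk wv : ℕ) : ∀ (x y n : ℕ), ∀ e ∈ peel wk wv x y n, e.2 < 2 ^ wv
  | _, _, 0, e, he => by simp [peel] at he
  | x, y, n + 1, e, he => by
    simp only [peel, List.mem_cons] at he
    rcases he with rfl | he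
    · show y &&& (2 ^ wv - 1) < 2 ^ wv
      rw [Nat.and_two_pow_sub_one_eq_mod]
      exact Nat.mod_lt _ (Nat.two_pow_pos _)
    · exact peel_val_lt wk wv _ _ n e he

/-- Every value of a decoded row of `U` is `< 2 ^ wv`. [folklore] -/
theorem Cert.uRowF_val_lt (C : Cert) (s : ℕ) : ∀ e ∈ C.uRowF s, e.2 < 2 ^ C.wv :=
  peel_val_lt _ _ _ _ _

/-! ## Base-`B` digit sums -/

/-- `digitSum B f K = ∑_{t < K} f t · B^t`. [folklore] -/
def digitSum (B : ℕ) (f : ℕ → ℕ) : ℕ → ℕ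
  | 0 => 0
  | K + 1 => digitSum B f K + f K * B ^ K

/-- `digitSum` as a `Finset` sum. [folklore] -/
theorem digitSum_eq_sum (B : ℕ) (f : ℕ → ℕ) (K : ℕ) :
    digitSum B f K = ∑ t ∈ range K, f t * B ^ t := by
  induction K with
  | zero => rfl
  | succ K ih => rw [digitSum, ih, sum_range_succ]

/-- `digitSum` only depends on the digits below `K`. [folklore] -/
theorem digitSum_congr {B : ℕ} {f g : ℕ → ℕ} {K : ℕ} (h : ∀ t < K, f t = g t) :
    digitSum B f K = digitSum B g K := by
  rw [digitSum_eq_sum, digitSum_eq_sum]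
  exact sum_congr rfl fun t ht => by rw [h t (mem_range.1 ht)]

/-- `digitSum` is additive in the digits. [folklore] -/
theorem digitSum_add (B : ℕ) (f g : ℕ → ℕ) (K : ℕ) :
    digitSum B f K + digitSum B g K = digitSum B (fun t => f t + g t) K := by
  simp only [digitSum_eq_sum, ← sum_add_distrib, add_mul]

/-- `digitSum` is homogeneous in the digits. [folklore] -/
theorem mul_digitSum (B c : ℕ) (f : ℕ → ℕ) (K : ℕ) :
    c * digitSum B f K = digitSum B (fun t => c * f t) K := by
  simp only [digitSum_eq_sum, mul_sum, mul_assoc]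

/-- A list sum of digit sums is the digit sum of the list sums. [folklore] -/
theorem sum_map_digitSum {α : Type*} (B : ℕ) (l : List α) (f : α → ℕ → ℕ) (K : ℕ) :
    (l.map fun a => digitSum B (f a) K).sum = digitSum B (fun t => (l.map fun a => f a t).sum) K := by
  induction l with
  | nil => simp [digitSum_eq_sum]
  | cons a l ih => simp only [List.map_cons, List.sum_cons, ih, digitSum_add]

/-- Honest digits make a number `< B^K`. [folklore] -/
theorem digitSum_lt {B : ℕ} {f : ℕ → ℕ} : ∀ {K : ℕ}, (∀ t < K, f t < B) → digitSum B f K < B ^ K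
  | 0, _ => by simp [digitSum]
  | K + 1, h => by
    rw [digitSum, pow_succ]
    have h1 := digitSum_lt (K := K) fun t ht => h t (Nat.lt_succ_of_lt ht)
    have h2 : f K + 1 ≤ B := h K (Nat.lt_succ_self K)
    calc digitSum B f K + f K * B ^ K < B ^ K + f K * B ^ K := by omega
      _ = (f K + 1) * B ^ K := by ring
      _ ≤ B * B ^ K := Nat.mul_le_mul_right _ h2
      _ = B ^ K * B := by ring

/-- **Digit extraction**: with honest digits, `digitSum B f K / B^u % B = f u` (`u < K`). [folklore] -/
theorem digitSum_div_mod {B : ℕ} (hB : 0 < B) {f : ℕ → ℕ} :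
    ∀ {K : ℕ}, (∀ t < K, f t < B) → ∀ {u : ℕ}, u < K → digitSum B f K / B ^ u % B = f u
  | 0, _, u, hu => absurd hu (Nat.not_lt_zero _)
  | K + 1, h, u, hu => by
    have h' : ∀ t < K, f t < B := fun t ht => h t (Nat.lt_succ_of_lt ht)
    rw [digitSum]
    rcases Nat.lt_succ_iff_lt_or_eq.1 hu with hu' | rfl
    · -- `u < K`: the top digit disappears modulo `B`
      obtain ⟨d, hd⟩ : ∃ d, K = u + 1 + d := ⟨K - (u + 1), by omega⟩
      have e : f K * B ^ K = (f K * B ^ d * B) * B ^ u := by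
        rw [hd]; ring
      rw [e, Nat.add_mul_div_right _ _ (pow_pos hB u), Nat.add_mul_mod_self_right]
      exact digitSum_div_mod hB h' hu'
    · -- `u = K`: the lower digits disappear in the division
      rw [Nat.add_mul_div_right _ _ (pow_pos hB u), Nat.div_eq_of_lt (digitSum_lt h'), zero_add]
      exact Nat.mod_eq_of_lt (h u (Nat.lt_succ_self u))

/-- **Uniqueness of digits.** [folklore] -/
theorem digitSum_injOn {B : ℕ} (hB : 0 < B) {f g : ℕ → ℕ} {K : ℕ} (hf : ∀ t < K, f t < B)
    (hg : ∀ t < K, g t < B) (h : digitSum B f K = digitSum B g K) {u : ℕ} (hu : u < K) : f u = g u := by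
  rw [← digitSum_div_mod hB hf hu, ← digitSum_div_mod hB hg hu, h]

/-! ## Packed rows (`20` bits per column) -/

/-- The field width. [folklore] -/
abbrev W : ℕ := 20

/-- A sparse row packed into one number: `∑_{(t,v) ∈ l} v · 2^{20 t}`. [folklore] -/
def packRow : List (ℕ × ℕ) → ℕ
  | [] => 0
  | e :: l => (e.2 <<< (W * e.1)) + packRow l

/-- A packed row is the digit sum of its `msum`s. [folklore] -/
theorem packRow_eq_digitSum {K : ℕ} :
    ∀ {l : List (ℕ × ℕ)}, (∀ e ∈ l, e.1 < K) → packRow l = digitSum (2 ^ W) (fun t => msum l t) K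
  | [], _ => by
    simp only [packRow, msum_nil]
    rw [digitSum_eq_sum, sum_eq_zero fun _ _ => by simp]
  | e :: l, h => by
    have hl : ∀ e' ∈ l, e'.1 < K := fun e' he' => h e' (List.mem_cons_of_mem _ he')
    rw [packRow, packRow_eq_digitSum hl, Nat.shiftLeft_eq, pow_mul]
    have hsplit : (fun t => msum (e :: l) t) = fun t => (if e.1 = t then e.2 else 0) + msum l t := by
      funext t; rfl
    rw [hsplit, ← digitSum_add]
    congr 1
    rw [digitSum_eq_sum]
    simp only [ite_mul, zero_mul]
    rw [sum_ite_eq, if_pos (mem_range.2 (h e List.mem_cons_self))]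

/-- Row `i` of `L · U`, packed: `packRow U_i + ∑_{(s,v) ∈ L_i} v · packRow U_s`, accumulated
tail-recursively. [folklore] -/
def accAux (C : Cert) : List (ℕ × ℕ) → ℕ → ℕ
  | [], acc => acc
  | e :: l, acc => accAux C l (acc + e.2 * packRow (C.uRowF e.1))

/-- Row `i` of `L · U`, packed. [folklore] -/
def accPacked (C : Cert) (i : ℕ) : ℕ := accAux C (C.lRowF i) (packRow (C.uRowF i))

/-- The exact (natural-number) entry `X_{it} = U_{it} + ∑_{(s,v) ∈ L_i} v U_{st}` of `L · U`.
[folklore] -/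
def Xnat (C : Cert) (i t : ℕ) : ℕ :=
  msum (C.uRowF i) t + ((C.lRowF i).map fun e => e.2 * msum (C.uRowF e.1) t).sum

/-- The accumulation is the sum of the scaled packed rows. [folklore] -/
theorem accAux_eq (C : Cert) : ∀ (l : List (ℕ × ℕ)) (acc : ℕ),
    accAux C l acc = acc + (l.map fun e => e.2 * packRow (C.uRowF e.1)).sum
  | [], acc => by simp [accAux]
  | e :: l, acc => by rw [accAux, accAux_eq C l]; simp [add_assoc]

/-- The packed row has the exact entries of `L · U` as digits (if all keys are `< K`). [folklore] -/
theorem accPacked_eq_digitSum (C : Cert) {K i : ℕ} (hU : ∀ e ∈ C.uRowF i, e.1 < K)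
    (hL : ∀ e ∈ C.lRowF i, ∀ e' ∈ C.uRowF e.1, e'.1 < K) :
    accPacked C i = digitSum (2 ^ W) (Xnat C i) K := by
  rw [accPacked, accAux_eq, packRow_eq_digitSum hU]
  have hmap : ((C.lRowF i).map fun e => e.2 * packRow (C.uRowF e.1)) =
      (C.lRowF i).map fun e => digitSum (2 ^ W) (fun t => e.2 * msum (C.uRowF e.1) t) K := by
    refine List.map_congr_left fun e he => ?_
    rw [packRow_eq_digitSum (hL e he), mul_digitSum]
  rw [hmap, sum_map_digitSum, digitSum_add]
  rfl

/-- The checked bound on the digits of row `i`: values are `< 2 ^ wv`. [folklore] -/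
def rowBound (C : Cert) (i : ℕ) : ℕ :=
  (2 ^ C.wv - 1) * (C.uRowF i).length +
    ((C.lRowF i).map fun e => e.2 * ((2 ^ C.wv - 1) * (C.uRowF e.1).length)).sum

/-- A value of a row is at most the value bound times its length. [folklore] -/
theorem msum_le_length_mul {l : List (ℕ × ℕ)} {m : ℕ} (h : ∀ e ∈ l, e.2 ≤ m) (t : ℕ) :
    msum l t ≤ m * l.length := by
  induction l with
  | nil => simp
  | cons e l ih =>
    rw [msum_cons, List.length_cons, Nat.mul_succ]
    have h1 : (if e.1 = t then e.2 else 0) ≤ m := by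
      split_ifs
      · exact h e List.mem_cons_self
      · exact Nat.zero_le _
    have h2 := ih fun e' he' => h e' (List.mem_cons_of_mem _ he')
    omega

/-- The exact entries are bounded by `rowBound`. [folklore] -/
theorem Xnat_le_rowBound (C : Cert) (i t : ℕ) : Xnat C i t ≤ rowBound C i := by
  have hv : ∀ s, ∀ e ∈ C.uRowF s, e.2 ≤ 2 ^ C.wv - 1 := fun s e he =>
    Nat.le_sub_one_of_lt (C.uRowF_val_lt s e he)
  unfold Xnat rowBound
  refine Nat.add_le_add (msum_le_length_mul (hv i) t) ?_
  refine List.sum_le_sum fun e _ => ?_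
  exact Nat.mul_le_mul_left _ (msum_le_length_mul (hv e.1) t)

/-! ## The field mask -/

/-- The mask of the bits `12, …, 19` of each of the `K` fields. [folklore] -/
def himask (K : ℕ) : ℕ := (2 ^ W - 2 ^ 12) * ((2 ^ (W * K) - 1) / (2 ^ W - 1))

/-- The geometric series behind the mask: `(2²⁰ - 1) ∑_{t<K} 2^{20t} = 2^{20K} - 1`. [folklore] -/
theorem geom_aux (K : ℕ) : (2 ^ W - 1) * digitSum (2 ^ W) (fun _ => 1) K = 2 ^ (W * K) - 1 := by
  induction K with
  | zero => simp [digitSum]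
  | succ K ih =>
    rw [digitSum, Nat.mul_add, ih, one_mul, Nat.mul_succ, pow_add]
    have h1 : 1 ≤ 2 ^ (W * K) := Nat.one_le_two_pow
    have h2 : 1 ≤ 2 ^ W := Nat.one_le_two_pow
    have h3 : (2 ^ W) ^ K = 2 ^ (W * K) := by rw [← pow_mul]
    rw [h3]
    zify [h1, h2, Nat.one_le_two_pow, Nat.mul_le_mul h1 h2]
    ring

/-- The mask is the digit sum of the constant digit `2²⁰ - 2¹²`. [folklore] -/
theorem himask_eq_digitSum (K : ℕ) : himask K = digitSum (2 ^ W) (fun _ => 2 ^ W - 2 ^ 12) K := by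
  have hpos : 0 < 2 ^ W - 1 := by decide
  have h := geom_aux K
  rw [himask, ← h, Nat.mul_div_cancel_left _ hpos, mul_digitSum]
  simp

/-- Bits of a number in terms of its `20`-bit fields. [folklore] -/
theorem testBit_field (x t j : ℕ) (hj : j < W) :
    x.testBit (W * t + j) = (x / 2 ^ (W * t) % 2 ^ W).testBit j := by
  rw [Nat.testBit_mod_two_pow, decide_eq_true hj, Bool.true_and, Nat.testBit_div_two_pow,
    Nat.add_comm]

/-- **What the mask certifies**: if `Q &&& himask K = 0` then every field of `Q` below `K` is
`< 2¹²`. [folklore] -/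
theorem digit_lt_of_and_himask_eq_zero {Q K : ℕ} (h : Q &&& himask K = 0) {t : ℕ} (ht : t < K) :
    Q / 2 ^ (W * t) % 2 ^ W < 2 ^ 12 := by
  have hmask : ∀ j, 12 ≤ j → j < W → (himask K).testBit (W * t + j) = true := by
    intro j hj1 hj2
    rw [testBit_field _ _ _ hj2, himask_eq_digitSum, pow_mul,
      digitSum_div_mod (Nat.two_pow_pos W) (fun _ _ => show 2 ^ W - 2 ^ 12 < 2 ^ W by decide) ht]
    change j < 20 at hj2
    interval_cases j <;> decide
  refine Nat.lt_pow_two_of_testBit _ fun j hj => ?_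
  by_cases hjW : j < W
  · have hb := congrArg (fun n => n.testBit (W * t + j)) h
    rw [Nat.testBit_and, Nat.zero_testBit, hmask j hj hjW, Bool.and_true, testBit_field _ _ _ hjW] at hb
    exact hb
  · exact Nat.testBit_lt_two_pow (lt_of_lt_of_le (Nat.mod_lt _ (Nat.two_pow_pos W))
      (Nat.pow_le_pow_right (by decide) (not_lt.1 hjW)))

/-! ## The candidate fold and the checker -/

section Checker

variable (pr : ℕ) (ent : ℕ → ℕ → ℕ) (cand : ℕ → List ℕ) (C : Cert)

/-- Visiting the candidate columns of the row with code `a`: for each candidate `b` that is a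
column of the minor (`cinv[b] = t + 1`), check that it is the `t`-th column, `t < k`, and that `t`
was not visited before, and add the residue of the entry of `A` to the field `t` of the packed
row `E`; return `E` (or `none` on failure). [folklore] -/
def candFold (a : ℕ) : List ℕ → List ℕ → ℕ → Option ℕ
  | [], _, E => some E
  | b :: bs, hits, E =>
    match C.cinvAt b with
    | 0 => candFold a bs hits E
    | t + 1 =>
      if C.col t = b ∧ t < C.k ∧ !(hits.elem t) then
        candFold a bs (t :: hits) (E + (ent a b % pr) <<< (W * t))
      else none

/-- **The check of row `i` (packed form)**: `U_i` on keys in `[i, k)` with non-zero diagonal, `L_i`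
on keys `< i`, the digit bound, and `acc = E + pr · Q` with `Q &&& himask = 0` for the packed rows
`acc` of `L · U` and `E` of `A` (on the visited columns). [folklore] -/
def rowCheckP (i : ℕ) : Bool :=
  ((C.uRowF i).all fun e => decide (i ≤ e.1) && decide (e.1 < C.k)) &&
  !decide (msum (C.uRowF i) i % pr = 0) &&
  ((C.lRowF i).all fun e => decide (e.1 < i)) &&
  decide (pr * rowBound C i < 2 ^ W) &&
  (match candFold pr ent C (C.row i) (cand (C.row i)) [] 0 with
    | none => false
    | some E =>
      match accPacked C i with
      | acc => decide (acc = E + pr * ((acc - E) / pr)) && decide ((acc - E) / pr &&& himask C.k = 0))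

/-- The checks of the rows `lo, …, lo + n - 1`. [folklore] -/
def rowsCheckP : ℕ → ℕ → Bool
  | _, 0 => true
  | lo, n + 1 => rowCheckP pr ent cand C lo && rowsCheckP (lo + 1) n

variable {pr ent cand C}

/-- A checked chunk certifies each of its rows. [folklore] -/
theorem rowsCheckP_spec {lo n : ℕ} (h : rowsCheckP pr ent cand C lo n = true) {i : ℕ}
    (hlo : lo ≤ i) (hhi : i < lo + n) : rowCheckP pr ent cand C i = true := by
  induction n generalizing lo with
  | zero => omega
  | succ n ih =>
    rw [rowsCheckP, Bool.and_eq_true] at h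
    rcases Nat.eq_or_lt_of_le hlo with rfl | hlt
    · exact h.1
    · exact ih h.2 hlt (by omega)

/-- What a successful candidate fold certifies: every candidate that is a column of the minor was
checked; the visited `t` are distinct and new; and the result is `E₀` plus the digit sum of the
residues on the visited columns. [folklore] -/
theorem candFold_spec {a : ℕ} :
    ∀ (bs hits₀ : List ℕ) (E₀ E : ℕ), candFold pr ent C a bs hits₀ E₀ = some E →
      ∃ hits : List ℕ,
        (∀ b ∈ bs, C.cinvAt b = 0 ∨ (C.col (C.cinvAt b - 1) = b ∧ C.cinvAt b - 1 < C.k ∧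
          C.cinvAt b - 1 ∈ hits)) ∧
        (∀ t ∈ hits, t ∉ hits₀ ∧ ∃ b ∈ bs, C.cinvAt b = t + 1) ∧ hits.Nodup ∧
        E = E₀ + (hits.map fun t => (ent a (C.col t) % pr) * 2 ^ (W * t)).sum
  | [], hits₀, E₀, E, h => by
    simp only [candFold, Option.some.injEq] at h
    exact ⟨[], by simp, by simp, List.nodup_nil, by simp [h]⟩
  | b :: bs, hits₀, E₀, E, h => by
    simp only [candFold] at h
    split at h
    · rename_i h0
      obtain ⟨hits, h1, h2, h3, h4⟩ := candFold_spec bs hits₀ E₀ E h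
      refine ⟨hits, ?_, ?_, h3, h4⟩
      · intro b' hb'
        rcases List.mem_cons.1 hb' with rfl | hb'
        · exact Or.inl h0
        · exact h1 b' hb'
      · intro t ht
        obtain ⟨h5, b', hb', h6⟩ := h2 t ht
        exact ⟨h5, b', List.mem_cons_of_mem _ hb', h6⟩
    · rename_i t ht
      split_ifs at h with hc
      obtain ⟨hcol, htk, hnew⟩ := hc
      have hnew' : t ∉ hits₀ := by simpa using hnew
      obtain ⟨hits, h1, h2, h3, h4⟩ := candFold_spec bs (t :: hits₀) _ E h
      refine ⟨t :: hits, ?_, ?_, ?_, ?_⟩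
      · intro b' hb'
        rcases List.mem_cons.1 hb' with rfl | hb'
        · right
          rw [ht, Nat.succ_sub_one]
          exact ⟨hcol, htk, List.mem_cons_self⟩
        · rcases h1 b' hb' with h5 | ⟨h5, h6, h7⟩
          · exact Or.inl h5
          · exact Or.inr ⟨h5, h6, List.mem_cons_of_mem _ h7⟩
      · intro t' ht'
        rcases List.mem_cons.1 ht' with rfl | ht'
        · exact ⟨hnew', b, List.mem_cons_self, ht⟩
        · obtain ⟨h5, b', hb', h6⟩ := h2 t' ht'
          exact ⟨fun hm => h5 (List.mem_cons_of_mem _ hm), b', List.mem_cons_of_mem _ hb', h6⟩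
      · exact List.nodup_cons.2 ⟨fun hm => (h2 t hm).1 List.mem_cons_self, h3⟩
      · rw [h4, List.map_cons, List.sum_cons, hcol, Nat.shiftLeft_eq]
        ring

end Checker

/-! ## Soundness -/

section Soundness

variable {pr : ℕ} {ent : ℕ → ℕ → ℕ} {cand : ℕ → List ℕ} {C : Cert} {colOK : ℕ → Bool}

/-- The digits of the packed row `E`: the residue of the entry on a visited column, else `0`.
[folklore] -/
theorem sum_hits_eq_digitSum (a : ℕ) {hits : List ℕ} (hnd : hits.Nodup) {K : ℕ}
    (hK : ∀ t ∈ hits, t < K) :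
    (hits.map fun t => (ent a (C.col t) % pr) * 2 ^ (W * t)).sum =
      digitSum (2 ^ W) (fun t => if t ∈ hits then ent a (C.col t) % pr else 0) K := by
  classical
  rw [digitSum_eq_sum]
  have e1 : (hits.map fun t => (ent a (C.col t) % pr) * 2 ^ (W * t)).sum =
      ∑ t ∈ hits.toFinset, (ent a (C.col t) % pr) * 2 ^ (W * t) := by
    rw [List.sum_toFinset _ hnd]
  rw [e1, ← sum_subset (fun t ht => mem_range.2 (hK t (List.mem_toFinset.1 ht)))
    (fun t _ ht => by rw [if_neg (fun h => ht (List.mem_toFinset.2 h)), zero_mul])]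
  exact sum_congr rfl fun t ht => by rw [if_pos (List.mem_toFinset.1 ht), pow_mul]

/-- Unpacking of a row check. [folklore] -/
theorem rowCheckP_spec {i : ℕ} (h : rowCheckP pr ent cand C i = true) :
    (∀ e ∈ C.uRowF i, i ≤ e.1 ∧ e.1 < C.k) ∧ msum (C.uRowF i) i % pr ≠ 0 ∧
      (∀ e ∈ C.lRowF i, e.1 < i) ∧ pr * rowBound C i < 2 ^ W ∧
      ∃ E, candFold pr ent C (C.row i) (cand (C.row i)) [] 0 = some E ∧
        accPacked C i = E + pr * ((accPacked C i - E) / pr) ∧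
        (accPacked C i - E) / pr &&& himask C.k = 0 := by
  unfold rowCheckP at h
  simp only [Bool.and_eq_true, List.all_eq_true, decide_eq_true_eq, Bool.not_eq_true',
    decide_eq_false_iff_not] at h
  obtain ⟨⟨⟨⟨h1, h2⟩, h3⟩, h4⟩, h5⟩ := h
  split at h5
  · exact absurd h5 Bool.false_ne_true
  · rename_i E hE
    simp only [Bool.and_eq_true, decide_eq_true_eq] at h5
    exact ⟨h1, h2, h3, h4, E, hE, h5.1, h5.2⟩

/-- **Soundness of the packed row-sparse LU certificate** (same statement as
`le_rank_of_checks`, for primes `pr < 2⁸`). [folklore] -/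
theorem le_rank_of_checksP {K : Type*} [Field K] [CharZero K] {m n : Type*} [Fintype m] [Fintype n]
    [DecidableEq m] [DecidableEq n] (A : Matrix m n ℤ) [hp : Fact pr.Prime]
    (decR : ℕ → m) (decC : ℕ → n)
    (hent : ∀ a b, ((ent a b : ℕ) : ZMod pr) = ((A (decR a) (decC b) : ℤ) : ZMod pr))
    (hcand : ∀ a b, colOK b = true → A (decR a) (decC b) ≠ 0 → b ∈ cand a) (hpr8 : pr < 2 ^ 8)
    (hglob : globalCheck C colOK = true) (hrows : ∀ i < C.k, rowCheckP pr ent cand C i = true) :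
    C.k ≤ (A.map (Int.castRingHom K)).rank := by
  classical
  have hpr : 0 < pr := hp.out.pos
  set k := C.k with hk
  let r : Fin k → m := fun i => decR (C.row i.val)
  let c : Fin k → n := fun j => decC (C.col j.val)
  -- the factors over `ZMod pr`
  let Lm : Matrix (Fin k) (Fin k) (ZMod pr) := fun i s =>
    if s.val < i.val then ((msum (C.lRowF i.val) s.val : ℕ) : ZMod pr) else if s = i then 1 else 0
  let Um : Matrix (Fin k) (Fin k) (ZMod pr) := fun s j => ((msum (C.uRowF s.val) j.val : ℕ) : ZMod pr)
  have hLm : ∀ i s : Fin k, Lm i s =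
      if s.val < i.val then ((msum (C.lRowF i.val) s.val : ℕ) : ZMod pr) else if s = i then 1 else 0 :=
    fun _ _ => rfl
  have hUm : ∀ s j : Fin k, Um s j = ((msum (C.uRowF s.val) j.val : ℕ) : ZMod pr) := fun _ _ => rfl
  -- `U` is upper triangular with non-zero diagonal
  have hUtri : Um.BlockTriangular id := by
    intro s j hjs
    have hjs' : j.val < s.val := hjs
    rw [hUm, msum_eq_zero_of_forall_ne, Nat.cast_zero]
    intro e he hej
    have := ((rowCheckP_spec (hrows s.val s.isLt)).1 e he).1
    omega
  have hUdet : Um.det ≠ 0 := by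
    rw [Matrix.det_of_upperTriangular hUtri]
    refine prod_ne_zero_iff.2 fun s _ => ?_
    rw [hUm, Ne, ZMod.natCast_eq_zero_iff]
    intro hd
    exact (rowCheckP_spec (hrows s.val s.isLt)).2.1 (Nat.mod_eq_zero_of_dvd hd)
  -- `L` is unit lower triangular
  have hLtri : Lm.BlockTriangular OrderDual.toDual := by
    intro i s his
    have his' : i.val < s.val := his
    rw [hLm, if_neg (by omega), if_neg (fun h => by rw [h] at his'; exact lt_irrefl _ his')]
  have hLdet : Lm.det = 1 := by
    rw [Matrix.det_of_lowerTriangular Lm hLtri]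
    refine prod_eq_one fun i _ => ?_
    rw [hLm, if_neg (lt_irrefl _), if_pos rfl]
  -- `(L · U) i j` is the exact entry `X`, modulo `pr`
  have hLUX : ∀ i j : Fin k, (Lm * Um) i j = ((Xnat C i.val j.val : ℕ) : ZMod pr) := by
    intro i j
    rw [Matrix.mul_apply, Xnat, Nat.cast_add, Nat.cast_list_sum, List.map_map]
    have hsplit : ∀ s : Fin k, Lm i s * Um s j = (if s = i then Um i j else 0) +
        (if s.val < i.val then
          ((msum (C.lRowF i.val) s.val : ℕ) : ZMod pr) * ((msum (C.uRowF s.val) j.val : ℕ) : ZMod pr)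
          else 0) := by
      intro s
      by_cases hs : s = i
      · subst hs
        rw [hLm, if_neg (lt_irrefl _), if_pos rfl, if_pos rfl, if_neg (lt_irrefl _), one_mul, add_zero]
      · by_cases hlt : s.val < i.val
        · rw [hLm, if_pos hlt, if_neg hs, if_pos hlt, zero_add]
        · rw [hLm, if_neg hlt, if_neg hs, if_neg hs, if_neg hlt, zero_mul, add_zero]
    rw [sum_congr rfl fun s _ => hsplit s, sum_add_distrib, sum_ite_eq']
    simp only [mem_univ, if_true]
    rw [hUm, sum_ite_msum_mul i (fun s => ((msum (C.uRowF s) j.val : ℕ) : ZMod pr)) (C.lRowF i.val)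
      (rowCheckP_spec (hrows i.val i.isLt)).2.2.1]
    congr 1
    refine congrArg List.sum (List.map_congr_left fun e _ => ?_)
    simp
  -- the exact entry is congruent to the entry of `A`
  have hXA : ∀ i j : Fin k, ((Xnat C i.val j.val : ℕ) : ZMod pr) = ((A (r i) (c j) : ℤ) : ZMod pr) := by
    intro i j
    obtain ⟨hU, -, hL, hbound, E, hE, hacc, hmask⟩ := rowCheckP_spec (hrows i.val i.isLt)
    obtain ⟨hits, h1, h2, hnd, hEsum⟩ := candFold_spec _ _ _ _ hE
    have hitsK : ∀ t ∈ hits, t < k := by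
      intro t ht
      obtain ⟨-, b, hb, hbt⟩ := h2 t ht
      rcases h1 b hb with h0 | ⟨-, htk, -⟩
      · rw [hbt] at h0; exact absurd h0 (Nat.succ_ne_zero _)
      · rw [hbt, Nat.add_sub_cancel] at htk; exact htk
    rw [zero_add, sum_hits_eq_digitSum _ hnd hitsK] at hEsum
    -- digits: `e` of `E`, `q` of `Q`, `X` of `acc`
    set a := C.row i.val with ha
    set e : ℕ → ℕ := fun t => if t ∈ hits then ent a (C.col t) % pr else 0 with he
    set Q := (accPacked C i.val - E) / pr with hQ
    set q : ℕ → ℕ := fun t => Q / 2 ^ (W * t) % 2 ^ W with hq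
    have hKU : ∀ e' ∈ C.uRowF i.val, e'.1 < k := fun e' he' => (hU e' he').2
    have hKL : ∀ e' ∈ C.lRowF i.val, ∀ e'' ∈ C.uRowF e'.1, e''.1 < k := by
      intro e' he' e'' he''
      have hs : e'.1 < k := lt_trans (hL e' he') i.isLt
      exact ((rowCheckP_spec (hrows e'.1 hs)).1 e'' he'').2
    have haccX := accPacked_eq_digitSum C hKU hKL
    -- `Q` as a digit sum
    have hB : 0 < 2 ^ W := Nat.two_pow_pos W
    have hQlt : Q < (2 ^ W) ^ k := by
      have h1 : accPacked C i.val < (2 ^ W) ^ k := by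
        rw [haccX]
        exact digitSum_lt fun t _ => lt_of_le_of_lt (Xnat_le_rowBound C i.val t)
          (lt_of_le_of_lt (Nat.le_mul_of_pos_left _ hpr) hbound)
      exact lt_of_le_of_lt (Nat.div_le_self _ _) (lt_of_le_of_lt (Nat.sub_le _ _) h1)
    have hQdig : Q = digitSum (2 ^ W) q k := by
      -- any number below `B^k` is the digit sum of its digits
      have key : ∀ (K x : ℕ), x < (2 ^ W) ^ K → x = digitSum (2 ^ W) (fun t => x / 2 ^ (W * t) % 2 ^ W) K := by
        intro K
        induction K with
        | zero => intro x hx; simp at hx; simp [digitSum, hx]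
        | succ K ih =>
          intro x hx
          rw [digitSum]
          have hx' : x % (2 ^ W) ^ K < (2 ^ W) ^ K := Nat.mod_lt _ (pow_pos hB K)
          have h1 := ih (x % (2 ^ W) ^ K) hx'
          have h2 : digitSum (2 ^ W) (fun t => x % (2 ^ W) ^ K / 2 ^ (W * t) % 2 ^ W) K =
              digitSum (2 ^ W) (fun t => x / 2 ^ (W * t) % 2 ^ W) K := by
            refine digitSum_congr fun t ht => ?_
            obtain ⟨d, hd⟩ : ∃ d, K = t + 1 + d := ⟨K - (t + 1), by omega⟩
            rw [show (2 ^ W) ^ K = 2 ^ (W * t) * (2 ^ W * (2 ^ W) ^ d) by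
              rw [hd, pow_add, pow_add, pow_one, pow_mul]; ring]
            rw [Nat.mod_mul_right_div_self, Nat.mod_mul_right_mod]
          rw [← h2, ← h1]
          have h3 : x / 2 ^ (W * K) % 2 ^ W = x / (2 ^ W) ^ K := by
            rw [← pow_mul]
            refine Nat.mod_eq_of_lt (Nat.div_lt_of_lt_mul ?_)
            have e : (2 : ℕ) ^ (W * K) * 2 ^ W = (2 ^ W) ^ (K + 1) := by
              rw [pow_succ ((2 : ℕ) ^ W) K, ← pow_mul]
            rw [e]
            exact hx
          rw [h3]
          exact (Nat.mod_add_div' x ((2 ^ W) ^ K)).symm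
      exact key k Q hQlt
    -- reading `acc = E + pr · Q` digit by digit
    have hq12 : ∀ t < k, q t < 2 ^ 12 := fun t ht => digit_lt_of_and_himask_eq_zero hmask ht
    have hXlt : ∀ t, Xnat C i.val t < 2 ^ W := fun t =>
      lt_of_le_of_lt (Xnat_le_rowBound C i.val t) (lt_of_le_of_lt (Nat.le_mul_of_pos_left _ hpr) hbound)
    have helt : ∀ t, e t < pr := by
      intro t
      simp only [he]
      split_ifs
      · exact Nat.mod_lt _ hpr
      · exact hpr
    have hdig : ∀ t < k, Xnat C i.val t = e t + pr * q t := by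
      have hsum : digitSum (2 ^ W) (Xnat C i.val) k = digitSum (2 ^ W) (fun t => e t + pr * q t) k := by
        rw [← haccX, hacc, hEsum, hQdig, ← digitSum_add, ← mul_digitSum]
      refine fun t ht => digitSum_injOn hB (fun t _ => hXlt t) (fun t ht => ?_) hsum ht
      have h1 := helt t
      have h2 := hq12 t ht
      have h3 : e t + pr * q t < pr * 2 ^ 12 := by
        calc e t + pr * q t < pr + pr * q t := by omega
          _ = pr * (q t + 1) := by ring
          _ ≤ pr * 2 ^ 12 := Nat.mul_le_mul_left _ h2
      calc e t + pr * q t < pr * 2 ^ 12 := h3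
        _ ≤ 2 ^ 8 * 2 ^ 12 := Nat.mul_le_mul_right _ hpr8.le
        _ = 2 ^ W := by norm_num
    -- hence `X ≡ e (mod pr)`, and `e` is the residue of the entry of `A`
    rw [hdig j.val j.isLt, Nat.cast_add, Nat.cast_mul, ZMod.natCast_self, zero_mul, add_zero]
    obtain ⟨hcinv, hok⟩ := globalCheck_spec hglob j.isLt
    by_cases hj : j.val ∈ hits
    · simp only [he, if_pos hj]
      rw [ZMod.natCast_mod, hent]
    · simp only [he, if_neg hj, Nat.cast_zero]
      symm
      rw [ZMod.intCast_zmod_eq_zero_iff_dvd]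
      suffices hA : A (r i) (c j) = 0 by rw [hA]; exact dvd_zero _
      by_contra hne
      have hb : C.col j.val ∈ cand a := hcand _ _ hok hne
      rcases h1 _ hb with h0 | ⟨-, -, hmem⟩
      · rw [hcinv] at h0; exact absurd h0 (Nat.succ_ne_zero _)
      · rw [hcinv, Nat.add_sub_cancel] at hmem
        exact hj hmem
  have hLU : Lm * Um = (A.submatrix r c).map (Int.castRingHom (ZMod pr)) := by
    ext i j
    rw [hLUX, hXA, Matrix.map_apply, Matrix.submatrix_apply, eq_intCast]
  -- conclude: the minor is non-zero modulo `pr`, hence over `ℤ` and over `K`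
  have hdetZ : (A.submatrix r c).det ≠ 0 := by
    intro hdet
    have h1 : ((A.submatrix r c).map (Int.castRingHom (ZMod pr))).det = 0 := by
      rw [← RingHom.mapMatrix_apply, ← RingHom.map_det, hdet, map_zero]
    rw [← hLU, Matrix.det_mul, hLdet, one_mul] at h1
    exact hUdet h1
  have hdetK : ((A.map (Int.castRingHom K)).submatrix r c).det ≠ 0 := by
    rw [show (A.map (Int.castRingHom K)).submatrix r c = (A.submatrix r c).map (Int.castRingHom K)
      from rfl, ← RingHom.mapMatrix_apply, ← RingHom.map_det, Ne, eq_intCast, Int.cast_eq_zero]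
    exact hdetZ
  have hunit : IsUnit ((A.map (Int.castRingHom K)).submatrix r c) :=
    (Matrix.isUnit_iff_isUnit_det _).2 (isUnit_iff_ne_zero.2 hdetK)
  have hrank := Matrix.rank_of_isUnit _ hunit
  rw [Fintype.card_fin] at hrank
  calc k = ((A.map (Int.castRingHom K)).submatrix r c).rank := hrank.symm
    _ ≤ (A.map (Int.castRingHom K)).rank := Matrix.rank_submatrix_le _ _ _

end Soundness

end RowLU

end Literature.Computability.AlgebraicComplexity
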